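import Mathlib.CategoryTheory.Limits.FullSubcategory
import Mathlib.CategoryTheory.Adjunction.Limits
import Literature.AnabelianGeometry.SemiGraphs.QuasiTemperoidsRemarksProofs
import Literature.AnabelianGeometry.SemiGraphs.TemperoidsProductDecomposition
import Literature.AnabelianGeometry.SemiGraphs.BTempCoproductsProofs
import HarnessLib

/-!
# Semi-graphs of anabelioids, Appendix: quasi-temperoids — Proposition A.2 (iii) (proof)

Mochizuki, *Semi-graphs of anabelioids*, Publ. RIMS **42** (2006), Appendix, Proposition A.2
(iii), manuscript p. 80 [cite: MochizukiSemiAnbd2006, Prop A.2(iii) p.80]: "The nondegenerate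
objects of `Q = ∏ Q_e` are precisely the objects each of whose component objects `∈ Ob(Q_e)` is
nonempty."  Proof-only companion of `QuasiTemperoids.lean` (no definitions): the named fact
`PropA2iii` is DISCHARGED.  Ingredients: in each factor `Q_e ≌ T_e[A_e] ⊆ B^temp(Π_e)` initial
objects exist and are strict, binary coproducts exist, and any two non-initial objects are dominated
by a common connected object (a coset object `Π_e/(Stab b ∩ Stab x)`); the product-category layer
(initial = coordinatewise initial; a connected object of `∏ Q_e` has exactly one non-initial
coordinate, which is connected; conversely such objects are connected) is the one built for
[SemiAnbd] Rmk. 3.1.5 (`TemperoidsProductLayer`/`TemperoidsProductDecomposition`, abc-iut-L3-t10).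
Nothing here takes a side on [IUTchIII] Cor. 3.12.
-/

open CategoryTheory CategoryTheory.Limits Topology

namespace Literature.AnabelianGeometry.SemiGraphs

open Literature.AlgebraicGeometry.Frobenioids (IsConnectedObj IsNonemptyObj)
open Literature.AlgebraicGeometry.Frobenioids.QuasiTemperoid (IsConnectedQuasiTemperoid)

universe v₁ u u₁

/-! ### The factors: `T[A]` has an initial object, binary coproducts, strict initial objects -/

section Factors

variable {G : Type u} [Group G] [TopologicalSpace G] [IsTopologicalGroup G]

/-- `C[A]` is closed under coproducts of any discrete shape (the coproduct maps to `A` through the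
maps of its summands). [cite: MochizukiSemiAnbd2006, §0 p.6] -/
theorem admitsHomTo_isClosedUnderColimitsOfShape_discrete {C : Type u₁} [Category.{v₁} C] (A : C)
    (J : Type) : (admitsHomTo A).IsClosedUnderColimitsOfShape (Discrete J) :=
  ⟨fun _ hX => by
    obtain ⟨p⟩ := hX
    exact ⟨p.isColimit.desc (Cocone.mk A (Discrete.natTrans fun j => (p.prop_diag_obj j).some))⟩⟩

/-- `T[A] ⊆ B^temp(Π)` has binary coproducts (computed in `B^temp(Π)`).
[cite: MochizukiSemiAnbd2006, Def A.1(i) p.79] -/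
theorem overPrime_hasBinaryCoproducts (A : BTemp G) : HasBinaryCoproducts (Over' A) := by
  haveI := BTemp.isClosedUnderColimitsOfShape_discrete (G := G) WalkingPair
  haveI : HasColimitsOfShape (Discrete WalkingPair) (BTemp G) :=
    hasColimitsOfShape_of_closedUnderColimits _ _
  haveI := admitsHomTo_isClosedUnderColimitsOfShape_discrete A WalkingPair
  exact hasColimitsOfShape_of_closedUnderColimits (Discrete WalkingPair) (admitsHomTo A)

omit [IsTopologicalGroup G] in
/-- `T[A]` has an initial object (the empty `Π`-set over `A`). [cite: MochizukiSemiAnbd2006, Def A.1(i) p.79] -/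
theorem overPrime_hasInitial (A : BTemp G) : HasInitial (Over' A) := by
  obtain ⟨X, hX⟩ := overPrime_exists_isEmpty A
  obtain ⟨hI⟩ := overPrime_isInitial_of_isEmpty X hX
  exact hI.hasInitial

/-- In `T[A]`: two objects with points are dominated by a common CONNECTED object — the coset object
`Π/(Stab b ∩ Stab x)` over `A`. [cite: MochizukiSemiAnbd2006, Def A.1(ii) p.79] -/
theorem overPrime_exists_isConnectedObj_hom_hom (hG : IsTempered G) {A : BTemp G} (B X : Over' A)
    (b : B.obj.obj.V) (x : X.obj.obj.V) :
    ∃ C : Over' A, IsConnectedObj C ∧ Nonempty (C ⟶ B) ∧ Nonempty (C ⟶ X) := by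
  letI : MulAction G B.obj.obj.V := Action.instMulAction B.obj.obj
  letI : MulAction G X.obj.obj.V := Action.instMulAction X.obj.obj
  let H : Subgroup G := MulAction.stabilizer G b ⊓ MulAction.stabilizer G x
  have hH : IsOpen (H : Set G) := (B.obj.property.2 b).inter (X.obj.property.2 x)
  obtain ⟨fB, -⟩ := GaloisObjects.exists_hom_quotientObj hG H hH (X := B.obj) b
    (fun k hk => (MulAction.mem_stabilizer_iff.mp (Subgroup.mem_inf.mp hk).1))
  obtain ⟨fX, -⟩ := GaloisObjects.exists_hom_quotientObj hG H hH (X := X.obj) x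
    (fun k hk => (MulAction.mem_stabilizer_iff.mp (Subgroup.mem_inf.mp hk).2))
  obtain ⟨pB⟩ := B.property
  refine ⟨⟨BTemp.quotientObj G hG H hH, ⟨fB ≫ pB⟩⟩,
    overPrime_isConnectedObj_of_isConnectedObj _ (GaloisObjects.isConnectedObj_quotientObj hG H hH),
    ⟨ObjectProperty.homMk fB⟩, ⟨ObjectProperty.homMk fX⟩⟩

end Factors

/-! ### The factors, abstractly: connected quasi-temperoids -/

section ConnectedQuasiTemperoid

variable {Q : Type u₁} [Category.{v₁} Q]

/-- A connected quasi-temperoid has an initial object. [cite: MochizukiSemiAnbd2006, Def A.1(i) p.79] -/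
theorem _root_.Literature.AlgebraicGeometry.Frobenioids.QuasiTemperoid.IsConnectedQuasiTemperoid.hasInitial
    (hQ : IsConnectedQuasiTemperoid.{v₁, u₁, u} Q) : HasInitial Q := by
  obtain ⟨c⟩ := isConnectedQuasiTemperoid_iff_nonempty_chart.mp hQ
  haveI := overPrime_hasInitial c.A
  exact Adjunction.hasColimitsOfShape_of_equivalence c.equiv.functor

/-- A connected quasi-temperoid has binary coproducts. [cite: MochizukiSemiAnbd2006, Def A.1(i) p.79] -/
theorem _root_.Literature.AlgebraicGeometry.Frobenioids.QuasiTemperoid.IsConnectedQuasiTemperoid.hasBinaryCoproducts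
    (hQ : IsConnectedQuasiTemperoid.{v₁, u₁, u} Q) : HasBinaryCoproducts Q := by
  obtain ⟨c⟩ := isConnectedQuasiTemperoid_iff_nonempty_chart.mp hQ
  haveI := overPrime_hasBinaryCoproducts c.A
  exact Adjunction.hasColimitsOfShape_of_equivalence c.equiv.functor

/-- In a connected quasi-temperoid an arrow out of a non-initial object has non-initial target
(strict initial objects). [cite: MochizukiSemiAnbd2006, Def A.1(i) p.79] -/
theorem _root_.Literature.AlgebraicGeometry.Frobenioids.QuasiTemperoid.IsConnectedQuasiTemperoid.isNonemptyObj_of_hom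
    (hQ : IsConnectedQuasiTemperoid.{v₁, u₁, u} Q) {A B : Q} (f : A ⟶ B) (hA : IsNonemptyObj A) :
    IsNonemptyObj B := by
  by_contra hB
  obtain ⟨hBI⟩ := TemperoidProduct.nonempty_isInitial_of_not_isNonemptyObj hB
  obtain ⟨hAI⟩ := hQ.nonempty_isInitial_of_hom hBI f
  exact hA.false hAI

/-- In a connected quasi-temperoid two non-initial objects are dominated by a common connected
object. [cite: MochizukiSemiAnbd2006, Def A.1(ii) p.79] -/
theorem _root_.Literature.AlgebraicGeometry.Frobenioids.QuasiTemperoid.IsConnectedQuasiTemperoid.exists_isConnectedObj_hom_hom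
    (hQ : IsConnectedQuasiTemperoid.{v₁, u₁, u} Q) {B X : Q} (hB : IsNonemptyObj B)
    (hX : IsNonemptyObj X) :
    ∃ C : Q, IsConnectedObj C ∧ Nonempty (C ⟶ B) ∧ Nonempty (C ⟶ X) := by
  obtain ⟨c⟩ := isConnectedQuasiTemperoid_iff_nonempty_chart.mp hQ
  let e := c.equiv
  obtain ⟨b⟩ := overPrime_nonempty_of_isNonemptyObj
    (TemperoidTransport.isNonemptyObj_functor_obj e hB)
  obtain ⟨x⟩ := overPrime_nonempty_of_isNonemptyObj
    (TemperoidTransport.isNonemptyObj_functor_obj e hX)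
  obtain ⟨C, hC, ⟨kB⟩, ⟨kX⟩⟩ :=
    overPrime_exists_isConnectedObj_hom_hom c.isTempered (e.functor.obj B) (e.functor.obj X) b x
  exact ⟨e.inverse.obj C, TemperoidTransport.isConnectedObj_functor_obj e.symm hC,
    ⟨e.inverse.map kB ≫ e.unitIso.inv.app B⟩, ⟨e.inverse.map kX ≫ e.unitIso.inv.app X⟩⟩

end ConnectedQuasiTemperoid

/-! ### Proposition A.2 (iii) -/

/-- **Proposition A.2 (iii), DISCHARGED** (SemiAnbd Appendix p. 80): in `Q = ∏_e Q_e` (connected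
quasi-temperoids `Q_e`) an object is nondegenerate iff all its coordinates are nonempty [non-initial].
(⇒): test against the connected object concentrated at `e` (a connected nondegenerate object of `Q_e`
there, initial elsewhere); a connected object dominating it is concentrated at `e` too, by strictness,
and maps to the `e`-th coordinate. (⇐): a connected `B` is concentrated at one `i₀` with `B_{i₀}`
connected; dominate `B_{i₀}` and `A_{i₀}` by a connected object of `Q_{i₀}` and extend by initial
objects. [cite: MochizukiSemiAnbd2006, Prop A.2(iii) p.80] -/
theorem PropA2iii_holds : PropA2iii.{v₁, u, u₁} := by
  intro E _ Q _ hQ X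
  classical
  haveI : ∀ f, HasInitial (Q f) := fun f => (hQ f).hasInitial
  haveI : ∀ f, HasBinaryCoproducts (Q f) := fun f => (hQ f).hasBinaryCoproducts
  have hstrict : ∀ f {A B : Q f} (_ : A ⟶ B), IsNonemptyObj A → IsNonemptyObj B :=
    fun f {_ _} k hA => (hQ f).isNonemptyObj_of_hom k hA
  have hbot : ∀ f, ¬ IsNonemptyObj (⊥_ (Q f)) := fun f h => h.false initialIsInitial
  constructor
  · -- (⇒)
    intro hX e
    -- a connected nondegenerate object in every factor
    have hN : ∀ f, ∃ N : Q f, IsConnectedObj N ∧ IsNondegenerateObj N :=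
      fun f => (hQ f).exists_isConnectedObj_isNondegenerateObj
    choose N hNc _ using hN
    let B : ∀ f, Q f := fun f => if f = e then N f else ⊥_ (Q f)
    have hBe : B e = N e := if_pos rfl
    have hBf : ∀ f, f ≠ e → B f = ⊥_ (Q f) := fun f hf => if_neg hf
    have hB : IsConnectedObj B := by
      refine TemperoidProduct.isConnectedObj_of_apply hstrict e ?_ ?_
      · rw [hBe]; exact hNc e
      · intro j hj; rw [hBf j hj]; exact hbot j
    obtain ⟨C, hC, ⟨k⟩, ⟨l⟩⟩ := hX B hB
    obtain ⟨i₀, hCi₀, hrest⟩ := TemperoidProduct.isConnectedObj_apply hC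
    by_cases hi : i₀ = e
    · subst hi
      exact hstrict _ (l i₀) hCi₀.1
    · exact absurd (hBf i₀ hi ▸ hstrict i₀ (k i₀) hCi₀.1) (hbot i₀)
  · -- (⇐)
    intro hX B hB
    obtain ⟨i₀, hBi₀, hrest⟩ := TemperoidProduct.isConnectedObj_apply hB
    -- a connected object over `B f` and `X f` wherever `B f` is nonempty, the initial object elsewhere
    have hdom : ∀ f, IsNonemptyObj (B f) →
        ∃ C : Q f, IsConnectedObj C ∧ Nonempty (C ⟶ B f) ∧ Nonempty (C ⟶ X f) :=
      fun f hBf => (hQ f).exists_isConnectedObj_hom_hom hBf (hX f)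
    let C : ∀ f, Q f := fun f =>
      if h : IsNonemptyObj (B f) then (hdom f h).choose else ⊥_ (Q f)
    have hCpos : ∀ f (h : IsNonemptyObj (B f)), C f = (hdom f h).choose := fun f h => dif_pos h
    have hCneg : ∀ f, ¬ IsNonemptyObj (B f) → C f = ⊥_ (Q f) := fun f h => dif_neg h
    refine ⟨C, ?_, ⟨fun f => ?_⟩, ⟨fun f => ?_⟩⟩
    · refine TemperoidProduct.isConnectedObj_of_apply hstrict i₀ ?_ ?_
      · rw [hCpos i₀ hBi₀.1]; exact (hdom i₀ hBi₀.1).choose_spec.1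
      · intro j hj; rw [hCneg j (hrest j hj)]; exact hbot j
    · by_cases h : IsNonemptyObj (B f)
      · exact eqToHom (hCpos f h) ≫ (hdom f h).choose_spec.2.1.some
      · exact eqToHom (hCneg f h) ≫ initial.to (B f)
    · by_cases h : IsNonemptyObj (B f)
      · exact eqToHom (hCpos f h) ≫ (hdom f h).choose_spec.2.2.some
      · exact eqToHom (hCneg f h) ≫ initial.to (X f)

end Literature.AnabelianGeometry.SemiGraphs
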